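import Literature.MathematicalPhysics.QuantumFieldTheory.Balaban1983to89.B8SockHFPWindows
import Literature.MathematicalPhysics.QuantumFieldTheory.Balaban1983to89.B8Thm4ExistsAtGammaRec

/-!
# `Balaban1983to89.B8SockHFPWindowsRec` — RECORD TWIN of `B8SockHFPWindows.hfpWindows_of_guard` ([Balaban1985RegularSpaces] Thm 4 p. 88 «there exists a constant c₁», (1.102)–(1.103) p. 93,
# (1.106) p. 94): the 27 scalar windows of the record Prop-5 socket bodies (`B8SockHFPRec`) FROM ONE GUARD, with the [3]-Prop-4 ∕ Props-8–9 windows in the RECORD form of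
# [Balaban1987RG1]'s centred averaging (`C0Z`, `exp(4c_Z·)(1 + 2·131072(d+1)²KZ²·) ≤ 2`, `KZ· ≤ c₃`, `1024·d·KZ·c_B ≤ 1`, `20·d·KZ·c_B ≤ 1/200`, the gauge-fixing constant `20dKZ·c_B`)

statement-level skeleton of published theorems with citation tags; proofs where landed; nothing here is a claim about the Yang–Mills mass gap

T. Bałaban, *Spaces of regular gauge field configurations on a lattice and gauge fixing conditions*, Commun. Math. Phys. **99** (1985) 75–102 `[Balaban1985RegularSpaces]` ("[6]"): Thm 4
p. 88, (1.102)–(1.103) p. 93, (1.106) p. 94, Prop. 3 p. 87, p. 89; T. Bałaban, *Renormalization group approach to lattice gauge field theories. I*, Commun. Math. Phys. **109** (1987)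
249–301 `[Balaban1987RG1]` ("[I]"): (0.3)–(0.4) pp. 252–253.  STATUS: published, refereed.

CITATION HEADER (lean-in-tree rule).  Cell `pub-ymgap`, «N05-REC» stage 2 (director-ym №254∕№255∕№288), item R6 (f)∕(g) (record sockets ∕ crown tail) — typed by the LEAD PEN dag-n05-e g39.  WHAT IS
REPRODUCED = ✓ `B8SockHFPWindows.hfpWindows_of_guard` (seat `pub-ymgap-dag-n05-d` g0) with the four [3]-windows and the gauge-fixing constant in record form; DEVICE = the engine's
`B8Thm4Windows.thm4_windows` (for `hside` and the engine-form (1.61) items, unchanged) + g38's record `B8Thm4ExistsAtGammaRec.thm4_windowsZ_γ` (for `C0Z·(L²α₀) ≤ ⅓`, `4L²α₀ ≤ c₂′`,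
the record exponential window and `KZ·(…) ≤ c₃` at `L·(2(L·c⋆) + 8α₄) ≥ c_B`, monotonicity) + `mul_le_one_of_le_inv` for the rest; proof text otherwise verbatim (`D4 := 4000·d·KZ·K_b`).
THEOREM NAME `hfpWindowsZ_of_guard` (namespace `…B8SockHFPWindowsRec`).  Kind «kernel-checked proof», one theorem; no `def`, no `instance`, no `notation`, no existing module modified.
`--supports stmt-QuantumFields-20541` (K0⁷-keyed, COUNT-NEUTRAL).

HONEST SCOPE: scalar bookkeeping («there exists a constant»); constants sufficient, not optimal; `HThm4Rec` UNDISCHARGED; caveat (C-S3-1) + addendum v4 stand; N05 [B8] DISCHARGED OF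
RECORD untouched; N05 ∕ N07 NOT discharged; COUNT of record unmoved · K numerically unchanged; one finite `𝕋⁴` programme at fixed `ε`, Bałaban AS PRINTED; nothing continuum ∕ ℝ⁴ ∕ OS ∕
mass-gap ∕ Clay.  No `sorry`, no `def`.

[cite: Balaban1985RegularSpaces, Theorem 4 p.88, (1.102)–(1.103) p.93, (1.106) p.94, Prop. 3 p.87, p.89; Balaban1987RG1, (0.3)–(0.4) pp.252–253]
-/

noncomputable section

namespace Literature.MathematicalPhysics.QuantumFieldTheory.Balaban1983to89.B8SockHFPWindowsRec

open B7Prop2Explicit (c2' c2'_pos)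
open B7Prop2Rec (C0Z C0Z_pos)
open B7Prop4GeneralLevelsRec (cZ gZ KZ gZ_nonneg cZ_nonneg)
open B7Prop3Flat (c3 c3_pos)
open B7Prop10General (C6 C7 C4G)
open B7Prop9Flat (C5')
open B7Prop10Flat (one_le_C5 C4'_nonneg C5'_nonneg)
open B7Eq214General (Cgen)
open B8Ineq125Concrete (C2p)
open B8Prop5ContractionKLevel (mWc Mc KWc Kc)
open B8Thm4Windows (mul_le_one_of_le_inv exp_le_of_small thm4_windows)
open B7ConclGaugeLin (two_le_C6' C4G_pos')
open B8SockHFPWindows (C2p_pos h103_of_scales h106_of_scales)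
open B8Thm4ExistsAtGammaRec (thm4_windowsZ_γ)

variable {d L : ℕ}

/-- **THE RECORD WINDOWS FROM ONE GUARD** (twin of `B8SockHFPWindows.hfpWindows_of_guard`): for `d, L ≥ 1`, `B₀, B₀′ > 0` with `2 ≤ 5dLB₀`, the [4]-letters constants `B₀′_H > 0`,
`B₂′, B_G, B_R ≥ 0`, a threshold `c_b9 > 0` and the free-constant condition `3·(2dL²)·B_G·B_R ≤ B₀′`, there is `cP > 0` such that for all `α₀, α₁ > 0` with `α₀ + α₁ ≤ cP`, at
`c⋆ = 5dLB₀(α₀+α₁)`, `α₄ = 8B₀′(5dLB₀)(α₀+α₁)`, `c_B = L·c⋆`, `c_DA = 2dL²c⋆` and the record Sect.-E sizes `h_E = B₀′_H·C′₂(20dKZ·c_B + α₄)α₄`, `h_E₂`, `l_E = B₀′_H·4C′₂(20dKZ·c_B + 2α₄)`,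
`l_E₂`: the same 27 windows as the engine's with items 7–11, 14, 17–18 in the RECORD form (`C0Z·α₀ ≤ ⅓`, `4α₀ ≤ c₂′`, `e^{4c_Zα₀}(1 + 2·131072(d+1)²KZ²c_B) ≤ 2`, `KZ·c_B ≤ c₃`,
`1024d·KZ·c_B ≤ 1`, `20d·KZ·c_B ≤ 1/200`, `C₄^G(α₀ + 20dKZ·c_B + 8α₄) ≤ 1`, `20dKZ·c_B + α₄ ≤ 1/(4B₀′_H·2C′₂)`, `2C₆(20dKZ·c_B + 4α₄) ≤ ⅛`).
[cite: Balaban1985RegularSpaces, Theorem 4 p.88 («there exists a constant c₁»), (1.102)–(1.103) p.93, (1.106) p.94; Balaban1987RG1, (0.4) p.253] -/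
theorem hfpWindowsZ_of_guard (hd : 1 ≤ d) (hL : 1 ≤ L) {B₀ B₀' B₀'H B₂' BG BR cB9 : ℝ} (hB₀ : 0 < B₀) (hB₀' : 0 < B₀')
    (hB : 2 ≤ 5 * (d : ℝ) * L * B₀) (hB₀'H : 0 < B₀'H) (hB₂' : 0 ≤ B₂') (hBG : 0 ≤ BG) (hBR : 0 ≤ BR) (hcB9 : 0 < cB9)
    (hfree : 3 * (2 * (d : ℝ) * (L : ℝ) ^ 2) * BG * BR ≤ B₀') :
    ∃ cP : ℝ, 0 < cP ∧ ∀ α₀ α₁ : ℝ, 0 < α₀ → 0 < α₁ → α₀ + α₁ ≤ cP →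
      ∀ cs α₄ cB cDA hE hE₂ lE lE₂ : ℝ, cs = 5 * (d : ℝ) * L * B₀ * (α₀ + α₁) → α₄ = 8 * B₀' * (5 * (d : ℝ) * L * B₀) * (α₀ + α₁) →
      cB = L * cs → cDA = 2 * (d : ℝ) * (L : ℝ) ^ 2 * cs →
      hE = B₀'H * (C2p d * (20 * d * KZ d L * cB + α₄) * α₄) → hE₂ = B₂' * (C2p d * (20 * d * KZ d L * cB + α₄) * α₄) →
      lE = B₀'H * (4 * C2p d * (20 * d * KZ d L * cB + 2 * α₄)) → lE₂ = B₂' * (4 * C2p d * (20 * d * KZ d L * cB + 2 * α₄)) →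
      -- Proposition 3's four windows not implied by the JOIN's
      36 * d * B₀ * cs ≤ 1 / 2 ∧
      8 * (131072 * ((d : ℝ) + 1) ^ 2) * Real.exp (4 * (800 * ((d : ℝ) + 1) ^ 2 * ((d : ℝ) + 4)) * α₀) ≤ 16 * (131072 * ((d : ℝ) + 1) ^ 2) ∧
      2 * cs ^ 2 + 20 * d * α₀ * cs + 2 * (16 * (131072 * ((d : ℝ) + 1) ^ 2)) * cs ^ 2 ≤ α₀ + α₁ ∧
      (d : ℝ) * L * α₁ ≤ 1 / 8 ∧
      -- the b9 thresholds
      α₀ ≤ cB9 ∧ cs ≤ cB9 ∧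
      -- the JOIN's windows, one-for-one
      C0Z d * α₀ ≤ 1 / 3 ∧ 4 * α₀ ≤ c2' d L ∧
      Real.exp (4 * cZ d * α₀) * (1 + 2 * (131072 * ((d : ℝ) + 1) ^ 2) * (KZ d L) ^ 2 * cB) ≤ 2 ∧
      KZ d L * cB ≤ c3 d L ∧ 1024 * (d : ℝ) * KZ d L * cB ≤ 1 ∧ 20 * d * KZ d L * cB ≤ 1 / 200 ∧
      200 * C6 d * (2 * α₄) ≤ 1 ∧ 12000 * ((d : ℝ) + 1) * L * (2 * α₄) ≤ 1 ∧
      C4G d L * (α₀ + 20 * d * KZ d L * cB + 4 * (2 * α₄)) ≤ 1 ∧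
      1024 * ((d : ℝ) + 1) * ((d : ℝ) + 4) * L ^ 2 * α₀ ≤ 1 ∧ 32 * ((d : ℝ) + 1) ^ 2 * C6 d * L ^ 2 * α₀ ≤ 1 ∧
      16 * d * C5' d * C6 d * (L : ℝ) ^ 2 * α₀ ≤ 1 ∧ 8 * d * C6 d * L * α₀ ≤ 1 ∧
      20 * d * KZ d L * cB + α₄ ≤ 1 / (4 * B₀'H * (2 * C2p d)) ∧ 2 * C6 d * (20 * d * KZ d L * cB + 4 * α₄) ≤ 1 / 8 ∧
      cB ≤ 1 / 13 ∧ α₄ / 4 + hE ≤ 1 / 24 ∧ α₄ / 4 + hE ≤ 1 / 140 ∧ 10 * (α₄ / 4 + hE) * BR ≤ 1 / 2 ∧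
      BG * Mc d BR (α₄ / 4 + hE) cB hE₂ cDA ≤ α₄ / 4 ∧
      BG * Kc d BR (α₄ / 4 + hE) cB hE₂ cDA lE₂ (1 + lE) (1 + lE) ≤ 1 / 2 := by
  -- shorthand
  have hd' : (1 : ℝ) ≤ d := by exact_mod_cast hd
  have hL' : (1 : ℝ) ≤ L := by exact_mod_cast hL
  have hd0 : (0 : ℝ) < d := by linarith only [hd']
  have hL0 : (0 : ℝ) < L := by linarith only [hL']
  have hC6 : (2 : ℝ) ≤ C6 d := two_le_C6'
  have hC60 : (0 : ℝ) ≤ C6 d := by linarith only [hC6]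
  have hC2 : 0 < C2p d := C2p_pos
  have hC4 : 0 ≤ C4G d L := (C4G_pos' d L).le
  have hC5 : (0 : ℝ) ≤ C5' d := C5'_nonneg
  -- Theorem 4's eighteen windows (n05-a) below `c₁`
  obtain ⟨c₁, hc₁, hw4⟩ := thm4_windows hd hL hB₀ hB₀' hB
  obtain ⟨c₁', hc₁', hw4'⟩ := thm4_windowsZ_γ (d := d) (L := L) hd hL hB₀ hB₀'
  have hKZ0 : 0 ≤ KZ d L := by unfold KZ; have := gZ_nonneg d L; positivity
  -- the scales: c⋆ = K₁S, c_B = KbS, α₄ = K₄S, c_DA = KDA·S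
  obtain ⟨K₁, hK₁⟩ : ∃ K₁ : ℝ, K₁ = 5 * d * L * B₀ := ⟨_, rfl⟩
  obtain ⟨Kb, hKb⟩ : ∃ Kb : ℝ, Kb = L * K₁ := ⟨_, rfl⟩
  obtain ⟨K₄, hK₄⟩ : ∃ K₄ : ℝ, K₄ = 8 * B₀' * K₁ := ⟨_, rfl⟩
  obtain ⟨KDA, hKDA⟩ : ∃ KDA : ℝ, KDA = 2 * d * (L : ℝ) ^ 2 * K₁ := ⟨_, rfl⟩
  have hK₁0 : 0 < K₁ := by rw [hK₁]; positivity
  have hKb0 : 0 < Kb := by rw [hKb]; positivity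
  have hK₄0 : 0 < K₄ := by rw [hK₄]; positivity
  have hKDA0 : 0 < KDA := by rw [hKDA]; positivity
  -- the Sect. E sizes per unit S (resp. S²): hE = KhE·S², lE = KlE·S
  obtain ⟨KhE, hKhE⟩ : ∃ KhE : ℝ, KhE = B₀'H * (C2p d * (20 * d * KZ d L * Kb + K₄) * K₄) := ⟨_, rfl⟩
  obtain ⟨KhE₂, hKhE₂⟩ : ∃ KhE₂ : ℝ, KhE₂ = B₂' * (C2p d * (20 * d * KZ d L * Kb + K₄) * K₄) := ⟨_, rfl⟩
  obtain ⟨KlE, hKlE⟩ : ∃ KlE : ℝ, KlE = B₀'H * (4 * C2p d * (20 * d * KZ d L * Kb + 2 * K₄)) := ⟨_, rfl⟩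
  obtain ⟨KlE₂, hKlE₂⟩ : ∃ KlE₂ : ℝ, KlE₂ = B₂' * (4 * C2p d * (20 * d * KZ d L * Kb + 2 * K₄)) := ⟨_, rfl⟩
  have hKhE0 : 0 ≤ KhE := by rw [hKhE]; positivity
  have hKhE₂0 : 0 ≤ KhE₂ := by rw [hKhE₂]; positivity
  have hKlE0 : 0 ≤ KlE := by rw [hKlE]; positivity
  have hKlE₂0 : 0 ≤ KlE₂ := by rw [hKlE₂]; positivity
  -- the majorants of b₁ = α₄/4 + hE, of m_W and of K_W per unit S
  obtain ⟨Kb₁, hKb₁⟩ : ∃ Kb₁ : ℝ, Kb₁ = K₄ / 4 + KhE := ⟨_, rfl⟩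
  have hKb₁0 : 0 ≤ Kb₁ := by rw [hKb₁]; positivity
  obtain ⟨R, hR⟩ : ∃ R : ℝ, R = 2 * KhE₂ + d * (82 * Kb₁ ^ 2 + 34 * Kb * Kb₁) := ⟨_, rfl⟩
  have hR0 : 0 ≤ R := by rw [hR]; positivity
  obtain ⟨KmW, hKmW⟩ : ∃ KmW : ℝ, KmW = 6 / 5 * KDA + R := ⟨_, rfl⟩
  have hKmW0 : 0 ≤ KmW := by rw [hKmW]; positivity
  obtain ⟨KKW, hKKW⟩ : ∃ KKW : ℝ, KKW = 36 * KDA + 2 * KlE₂ + 20 * KhE₂ + d * (876 * Kb₁ + 3936 * Kb₁ ^ 2 + 136 * Kb + 1616 * Kb * Kb₁) := ⟨_, rfl⟩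
  have hKKW0 : 0 ≤ KKW := by rw [hKKW]; positivity
  obtain ⟨KKc, hKKc⟩ : ∃ KKc : ℝ, KKc = 2 * BR * (KKW + 40 * BR * KmW) := ⟨_, rfl⟩
  have hKKc0 : 0 ≤ KKc := by rw [hKKc]; positivity
  -- the coefficients of the new windows
  obtain ⟨D1, hD1⟩ : ∃ D1 : ℝ, D1 = 1 / cB9 := ⟨_, rfl⟩
  obtain ⟨D2, hD2⟩ : ∃ D2 : ℝ, D2 = K₁ / cB9 := ⟨_, rfl⟩
  obtain ⟨D3, hD3⟩ : ∃ D3 : ℝ, D3 = 8 * d * L := ⟨_, rfl⟩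
  obtain ⟨D4, hD4⟩ : ∃ D4 : ℝ, D4 = 4000 * d * KZ d L * Kb := ⟨_, rfl⟩
  obtain ⟨D5, hD5⟩ : ∃ D5 : ℝ, D5 = 400 * C6 d * K₄ := ⟨_, rfl⟩
  obtain ⟨D6, hD6⟩ : ∃ D6 : ℝ, D6 = 24000 * ((d : ℝ) + 1) * L * K₄ := ⟨_, rfl⟩
  obtain ⟨D7, hD7⟩ : ∃ D7 : ℝ, D7 = C4G d L * (1 + 20 * d * KZ d L * Kb + 8 * K₄) := ⟨_, rfl⟩
  obtain ⟨D8, hD8⟩ : ∃ D8 : ℝ, D8 = 1024 * ((d : ℝ) + 1) * ((d : ℝ) + 4) * L ^ 2 := ⟨_, rfl⟩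
  obtain ⟨D9, hD9⟩ : ∃ D9 : ℝ, D9 = 32 * ((d : ℝ) + 1) ^ 2 * C6 d * L ^ 2 := ⟨_, rfl⟩
  obtain ⟨D10, hD10⟩ : ∃ D10 : ℝ, D10 = 16 * d * C5' d * C6 d * (L : ℝ) ^ 2 := ⟨_, rfl⟩
  obtain ⟨D11, hD11⟩ : ∃ D11 : ℝ, D11 = 8 * d * C6 d * L := ⟨_, rfl⟩
  obtain ⟨D12, hD12⟩ : ∃ D12 : ℝ, D12 = (20 * d * KZ d L * Kb + K₄) * (8 * B₀'H * C2p d) := ⟨_, rfl⟩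
  obtain ⟨D13, hD13⟩ : ∃ D13 : ℝ, D13 = 16 * C6 d * (20 * d * KZ d L * Kb + 4 * K₄) := ⟨_, rfl⟩
  obtain ⟨D14, hD14⟩ : ∃ D14 : ℝ, D14 = 13 * Kb := ⟨_, rfl⟩
  obtain ⟨D15, hD15⟩ : ∃ D15 : ℝ, D15 = 1 := ⟨_, rfl⟩
  obtain ⟨D16, hD16⟩ : ∃ D16 : ℝ, D16 = 140 * Kb₁ := ⟨_, rfl⟩
  obtain ⟨D17, hD17⟩ : ∃ D17 : ℝ, D17 = 20 * BR * Kb₁ := ⟨_, rfl⟩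
  obtain ⟨D18, hD18⟩ : ∃ D18 : ℝ, D18 = KlE := ⟨_, rfl⟩
  obtain ⟨D19, hD19⟩ : ∃ D19 : ℝ, D19 = 2 * BG * KKc := ⟨_, rfl⟩
  obtain ⟨D20, hD20⟩ : ∃ D20 : ℝ, D20 = 2 * BG * BR * R / (6 / 5 * B₀' * K₁) := ⟨_, rfl⟩
  have h1 : 0 ≤ D1 := by rw [hD1]; positivity
  have h2 : 0 ≤ D2 := by rw [hD2]; positivity
  have h3 : 0 ≤ D3 := by rw [hD3]; positivity
  have h4 : 0 ≤ D4 := by rw [hD4]; positivity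
  have h5 : 0 ≤ D5 := by rw [hD5]; positivity
  have h6 : 0 ≤ D6 := by rw [hD6]; positivity
  have h7 : 0 ≤ D7 := by rw [hD7]; positivity
  have h8 : 0 ≤ D8 := by rw [hD8]; positivity
  have h9 : 0 ≤ D9 := by rw [hD9]; positivity
  have h10 : 0 ≤ D10 := by rw [hD10]; positivity
  have h11 : 0 ≤ D11 := by rw [hD11]; positivity
  have h12 : 0 ≤ D12 := by rw [hD12]; positivity
  have h13 : 0 ≤ D13 := by rw [hD13]; positivity
  have h14 : 0 ≤ D14 := by rw [hD14]; positivity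
  have h15 : 0 ≤ D15 := by rw [hD15]; norm_num
  have h16 : 0 ≤ D16 := by rw [hD16]; positivity
  have h17 : 0 ≤ D17 := by rw [hD17]; positivity
  have h18 : 0 ≤ D18 := by rw [hD18]; positivity
  have h19 : 0 ≤ D19 := by rw [hD19]; positivity
  have h20 : 0 ≤ D20 := by rw [hD20]; positivity
  -- one threshold per coefficient: `S ≤ 1/(Dᵢ + 1)` gives `Dᵢ·S ≤ 1`
  have tpos : ∀ {D : ℝ}, 0 ≤ D → 0 < 1 / (D + 1) := fun h => by positivity
  obtain ⟨T, hT⟩ : ∃ T : ℝ, T = min (1 / (D1 + 1)) (min (1 / (D2 + 1)) (min (1 / (D3 + 1)) (min (1 / (D4 + 1)) (min (1 / (D5 + 1)) (min (1 / (D6 + 1)) (min (1 / (D7 + 1)) (min (1 / (D8 + 1)) (min (1 / (D9 + 1)) (min (1 / (D10 + 1)) (min (1 / (D11 + 1)) (min (1 / (D12 + 1)) (min (1 / (D13 + 1)) (min (1 / (D14 + 1)) (min (1 / (D15 + 1)) (min (1 / (D16 + 1)) (min (1 / (D17 + 1)) (min (1 / (D18 + 1)) (min (1 / (D19 + 1))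 (1 / (D20 + 1)))))))))))))))))))) := ⟨_, rfl⟩
  have hT0 : 0 < T := by
    rw [hT]
    exact lt_min (tpos h1) (lt_min (tpos h2) (lt_min (tpos h3) (lt_min (tpos h4) (lt_min (tpos h5) (lt_min (tpos h6) (lt_min (tpos h7) (lt_min (tpos h8) (lt_min (tpos h9) (lt_min (tpos h10) (lt_min (tpos h11) (lt_min (tpos h12) (lt_min (tpos h13) (lt_min (tpos h14) (lt_min (tpos h15) (lt_min (tpos h16) (lt_min (tpos h17) (lt_min (tpos h18) (lt_min (tpos h19) (tpos h20)))))))))))))))))))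
  refine ⟨min (min c₁ c₁') T, lt_min (lt_min hc₁ hc₁') hT0, ?_⟩
  intro α₀ α₁ hα₀ hα₁ hguard cs α₄ cB cDA hE hE₂ lE lE₂ hcs hα₄ hcB hcDA hhE hhE₂ hlE hlE₂
  have hS₁ : α₀ + α₁ ≤ c₁ := hguard.trans ((min_le_left _ _).trans (min_le_left _ _))
  have hS₁' : α₀ + α₁ ≤ c₁' := hguard.trans ((min_le_left _ _).trans (min_le_right _ _))
  have hS : α₀ + α₁ ≤ T := hguard.trans (min_le_right _ _)
  -- Theorem 4's windows at (c⋆, α₄): engine (for `hside`, (1.61)) and record γ (for the [3]-Prop-4 / Props-8–9 windows)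
  obtain ⟨w1, w2, w3, w4, w5, w6, w7, w8, w9, w10, w11, w12, w13, w14, w15, w16, w17, w18⟩ := hw4 α₀ α₁ hα₀ hα₁ hS₁ cs α₄ hcs hα₄
  obtain ⟨g5, g6, g9, g10, -, -⟩ := hw4' α₀ α₁ hα₀ hα₁ hS₁' cs α₄ hcs hα₄
  obtain ⟨S, hSdef⟩ : ∃ S : ℝ, S = α₀ + α₁ := ⟨_, rfl⟩
  rw [← hSdef] at hS
  have hS0 : 0 ≤ S := by rw [hSdef]; linarith only [hα₀, hα₁]
  have hSpos : 0 < S := by rw [hSdef]; linarith only [hα₀, hα₁]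
  have hα₀S : α₀ ≤ S := by rw [hSdef]; linarith only [hα₁]
  have hα₁S : α₁ ≤ S := by rw [hSdef]; linarith only [hα₀]
  -- the scales in terms of S
  have hcsS : cs = K₁ * S := by rw [hcs, hK₁, hSdef]
  have hcBS : cB = Kb * S := by rw [hcB, hcsS, hKb]; ring
  have hα₄S : α₄ = K₄ * S := by rw [hα₄, hK₄, hK₁, hSdef]
  have hcDAS : cDA = KDA * S := by rw [hcDA, hcsS, hKDA]; ring
  have hES : hE = KhE * S ^ 2 := by rw [hhE, hcBS, hα₄S, hKhE]; ring
  have hE₂S : hE₂ = KhE₂ * S ^ 2 := by rw [hhE₂, hcBS, hα₄S, hKhE₂]; ring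
  have hlES : lE = KlE * S := by rw [hlE, hcBS, hα₄S, hKlE]; ring
  have hlE₂S : lE₂ = KlE₂ * S := by rw [hlE₂, hcBS, hα₄S, hKlE₂]; ring
  have hcs0 : 0 ≤ cs := by rw [hcsS]; positivity
  have hcB0 : 0 ≤ cB := by rw [hcBS]; positivity
  have hα₄0 : 0 ≤ α₄ := by rw [hα₄S]; positivity
  have hcDA0 : 0 ≤ cDA := by rw [hcDAS]; positivity
  have hhE0 : 0 ≤ hE := by rw [hES]; positivity
  have hhE₂0 : 0 ≤ hE₂ := by rw [hE₂S]; positivity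
  have hlE0 : 0 ≤ lE := by rw [hlES]; positivity
  -- `c⋆ ≤ c_B ≤ 2(L·c⋆) + 8α₄`
  have hcsB : cs ≤ cB := by rw [hcB]; exact le_mul_of_one_le_left hcs0 hL'
  have hcBX : cB ≤ 2 * (L * cs) + 8 * α₄ := by rw [hcB]; nlinarith only [hcs0, hα₄0, hL0]
  have hcsX : cs ≤ 2 * (L * cs) + 8 * α₄ := hcsB.trans hcBX
  -- peel the thresholds: `Dᵢ·S ≤ 1`
  have dev : ∀ {D : ℝ}, 0 ≤ D → S ≤ 1 / (D + 1) → D * S ≤ 1 := fun {D} hD h =>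
    mul_le_one_of_le_inv (by linarith only [hD] : D ≤ D + 1) (by linarith only [hD]) hS0 h
  rw [hT] at hS
  have e1 : D1 * S ≤ 1 := dev h1 (hS.trans (min_le_left _ _))
  have hT2 := hS.trans (min_le_right _ _)
  have e2 : D2 * S ≤ 1 := dev h2 (hT2.trans (min_le_left _ _))
  have hT3 := hT2.trans (min_le_right _ _)
  have e3 : D3 * S ≤ 1 := dev h3 (hT3.trans (min_le_left _ _))
  have hT4 := hT3.trans (min_le_right _ _)
  have e4 : D4 * S ≤ 1 := dev h4 (hT4.trans (min_le_left _ _))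
  have hT5 := hT4.trans (min_le_right _ _)
  have e5 : D5 * S ≤ 1 := dev h5 (hT5.trans (min_le_left _ _))
  have hT6 := hT5.trans (min_le_right _ _)
  have e6 : D6 * S ≤ 1 := dev h6 (hT6.trans (min_le_left _ _))
  have hT7 := hT6.trans (min_le_right _ _)
  have e7 : D7 * S ≤ 1 := dev h7 (hT7.trans (min_le_left _ _))
  have hT8 := hT7.trans (min_le_right _ _)
  have e8 : D8 * S ≤ 1 := dev h8 (hT8.trans (min_le_left _ _))
  have hT9 := hT8.trans (min_le_right _ _)
  have e9 : D9 * S ≤ 1 := dev h9 (hT9.trans (min_le_left _ _))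
  have hT10 := hT9.trans (min_le_right _ _)
  have e10 : D10 * S ≤ 1 := dev h10 (hT10.trans (min_le_left _ _))
  have hT11 := hT10.trans (min_le_right _ _)
  have e11 : D11 * S ≤ 1 := dev h11 (hT11.trans (min_le_left _ _))
  have hT12 := hT11.trans (min_le_right _ _)
  have e12 : D12 * S ≤ 1 := dev h12 (hT12.trans (min_le_left _ _))
  have hT13 := hT12.trans (min_le_right _ _)
  have e13 : D13 * S ≤ 1 := dev h13 (hT13.trans (min_le_left _ _))
  have hT14 := hT13.trans (min_le_right _ _)
  have e14 : D14 * S ≤ 1 := dev h14 (hT14.trans (min_le_left _ _))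
  have hT15 := hT14.trans (min_le_right _ _)
  have e15 : D15 * S ≤ 1 := dev h15 (hT15.trans (min_le_left _ _))
  have hT16 := hT15.trans (min_le_right _ _)
  have e16 : D16 * S ≤ 1 := dev h16 (hT16.trans (min_le_left _ _))
  have hT17 := hT16.trans (min_le_right _ _)
  have e17 : D17 * S ≤ 1 := dev h17 (hT17.trans (min_le_left _ _))
  have hT18 := hT17.trans (min_le_right _ _)
  have e18 : D18 * S ≤ 1 := dev h18 (hT18.trans (min_le_left _ _))
  have hT19 := hT18.trans (min_le_right _ _)
  have e19 : D19 * S ≤ 1 := dev h19 (hT19.trans (min_le_left _ _))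
  have e20 : D20 * S ≤ 1 := dev h20 (hT19.trans (min_le_right _ _))
  -- `S ≤ 1`, `S² ≤ S`, `lE ≤ 1`
  have hS1 : S ≤ 1 := by rw [hD15] at e15; linarith only [e15]
  have hS2 : S ^ 2 ≤ S := by nlinarith only [hS0, hS1]
  have hlE1 : lE ≤ 1 := by rw [hlES, ← hD18]; exact e18
  -- `b₁ = α₄/4 + hE ≤ Kb₁·S`, `hE₂ ≤ KhE₂·S`
  have hb₁S : α₄ / 4 + hE ≤ Kb₁ * S := by
    rw [hα₄S, hES, hKb₁]
    nlinarith only [hS2, hKhE0, hK₄0.le, hS0]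
  have hb₁0 : 0 ≤ α₄ / 4 + hE := by positivity
  have hE₂S' : hE₂ ≤ KhE₂ * S := by rw [hE₂S]; nlinarith only [hS2, hKhE₂0]
  refine ⟨?_, w13, ?_, ?_, ?_, ?_, ?_, ?_, ?_, ?_, ?_, ?_, ?_, ?_, ?_, ?_, ?_, ?_, ?_, ?_, ?_, ?_, ?_, ?_, ?_, ?_, ?_⟩
  · -- 36 d B₀ c⋆ ≤ 1/2
    have h₁ : 36 * d * B₀ * cs ≤ 36 * d * B₀ * (2 * (L * cs) + 8 * α₄) := mul_le_mul_of_nonneg_left hcsX (by positivity)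
    exact h₁.trans w11
  · -- (1.61) at c⋆ from (1.61) at 2(Lc⋆) + 8α₄
    have hX0 : 0 ≤ 2 * (L * cs) + 8 * α₄ := hcs0.trans hcsX
    have h₁ : cs ^ 2 ≤ (2 * (L * cs) + 8 * α₄) ^ 2 := pow_le_pow_left₀ hcs0 hcsX 2
    have h₂ : 20 * d * α₀ * cs ≤ 20 * d * α₀ * (2 * (L * cs) + 8 * α₄) := mul_le_mul_of_nonneg_left hcsX (by positivity)
    have h₃ : 2 * (16 * (131072 * ((d : ℝ) + 1) ^ 2)) * cs ^ 2 ≤ 2 * (16 * (131072 * ((d : ℝ) + 1) ^ 2)) * (2 * (L * cs) + 8 * α₄) ^ 2 :=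
      mul_le_mul_of_nonneg_left h₁ (by positivity)
    linarith only [h₁, h₂, h₃, w14]
  · -- dLα₁ ≤ 1/8
    rw [hD3] at e3
    have h₁ : (d : ℝ) * L * α₁ ≤ d * L * S := mul_le_mul_of_nonneg_left hα₁S (by positivity)
    linarith only [h₁, e3]
  · -- α₀ ≤ c_b9
    rw [hD1] at e1
    have h₁ : 1 / cB9 * S * cB9 ≤ 1 * cB9 := mul_le_mul_of_nonneg_right e1 hcB9.le
    have h₂ : 1 / cB9 * S * cB9 = S := by field_simp
    linarith only [h₁, h₂, hα₀S]
  · -- c⋆ ≤ c_b9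
    rw [hD2] at e2
    have h₁ : K₁ / cB9 * S * cB9 ≤ 1 * cB9 := mul_le_mul_of_nonneg_right e2 hcB9.le
    have h₂ : K₁ / cB9 * S * cB9 = K₁ * S := by field_simp
    rw [hcsS]; linarith only [h₁, h₂]
  · -- C₀^Z α₀ ≤ 1/3 (from the γ window at L²α₀)
    have hL2 : α₀ ≤ (L : ℝ) ^ 2 * α₀ := le_mul_of_one_le_left hα₀.le (one_le_pow₀ hL')
    exact (mul_le_mul_of_nonneg_left hL2 (C0Z_pos d).le).trans g5
  · -- 4α₀ ≤ c₂′
    have hL2 : α₀ ≤ (L : ℝ) ^ 2 * α₀ := le_mul_of_one_le_left hα₀.le (one_le_pow₀ hL')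
    linarith only [hL2, g6]
  · -- record exp window at c_B (from the γ window at L·(2Lc⋆ + 8α₄) ≥ c_B)
    have hcZ0 : 0 ≤ cZ d := cZ_nonneg d
    have hL2 : α₀ ≤ (L : ℝ) ^ 2 * α₀ := le_mul_of_one_le_left hα₀.le (one_le_pow₀ hL')
    have hexp : Real.exp (4 * cZ d * α₀) ≤ Real.exp (4 * cZ d * ((L : ℝ) ^ 2 * α₀)) :=
      Real.exp_le_exp.mpr (mul_le_mul_of_nonneg_left hL2 (by positivity))
    have hcBX' : cB ≤ (L : ℝ) * (2 * (L * cs) + 8 * α₄) := by rw [hcB]; nlinarith only [hcs0, hα₄0, hL0, hcsX]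
    have h₁ : 1 + 2 * (131072 * ((d : ℝ) + 1) ^ 2) * (KZ d L) ^ 2 * cB ≤
        1 + 2 * (131072 * ((d : ℝ) + 1) ^ 2) * (KZ d L) ^ 2 * ((L : ℝ) * (2 * (L * cs) + 8 * α₄)) := by
      have := mul_le_mul_of_nonneg_left hcBX' (show (0 : ℝ) ≤ 2 * (131072 * ((d : ℝ) + 1) ^ 2) * (KZ d L) ^ 2 by positivity)
      linarith only [this]
    have h₂ : 0 ≤ 1 + 2 * (131072 * ((d : ℝ) + 1) ^ 2) * (KZ d L) ^ 2 * cB := by positivity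
    calc Real.exp (4 * cZ d * α₀) * (1 + 2 * (131072 * ((d : ℝ) + 1) ^ 2) * (KZ d L) ^ 2 * cB)
        ≤ Real.exp (4 * cZ d * ((L : ℝ) ^ 2 * α₀)) * (1 + 2 * (131072 * ((d : ℝ) + 1) ^ 2) * (KZ d L) ^ 2 * cB) :=
          mul_le_mul_of_nonneg_right hexp h₂
      _ ≤ Real.exp (4 * cZ d * ((L : ℝ) ^ 2 * α₀)) * (1 + 2 * (131072 * ((d : ℝ) + 1) ^ 2) * (KZ d L) ^ 2 * ((L : ℝ) * (2 * (L * cs) + 8 * α₄))) :=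
          mul_le_mul_of_nonneg_left h₁ (Real.exp_pos _).le
      _ ≤ 2 := g9
  · -- KZ·c_B ≤ c₃
    have hcBX' : cB ≤ (L : ℝ) * (2 * (L * cs) + 8 * α₄) := by rw [hcB]; nlinarith only [hcs0, hα₄0, hL0, hcsX]
    exact (mul_le_mul_of_nonneg_left hcBX' hKZ0).trans g10
  · -- 1024 d KZ c_B ≤ 1
    rw [hD4] at e4
    have e : 4000 * (d : ℝ) * KZ d L * Kb * S = 4000 * (d * KZ d L * cB) := by rw [hcBS]; ring
    rw [e] at e4
    have hdc : 0 ≤ (d : ℝ) * KZ d L * cB := by positivity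
    linarith only [e4, hdc]
  · -- 20 d KZ c_B ≤ 1/200
    rw [hD4] at e4
    have e : 4000 * (d : ℝ) * KZ d L * Kb * S = 4000 * (d * KZ d L * cB) := by rw [hcBS]; ring
    rw [e] at e4
    linarith only [e4]
  · -- 200 C₆ (2α₄) ≤ 1
    rw [hD5] at e5
    have e : 400 * C6 d * K₄ * S = 200 * C6 d * (2 * α₄) := by rw [hα₄S]; ring
    linarith only [e5, e]
  · -- 12000(d+1)L(2α₄) ≤ 1
    rw [hD6] at e6
    have e : 24000 * ((d : ℝ) + 1) * L * K₄ * S = 12000 * ((d : ℝ) + 1) * L * (2 * α₄) := by rw [hα₄S]; ring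
    linarith only [e6, e]
  · -- C₄^G (α₀ + 40 d c_B + 8α₄) ≤ 1
    rw [hD7] at e7
    have h₁ : α₀ + 20 * d * KZ d L * cB + 4 * (2 * α₄) ≤ (1 + 20 * d * KZ d L * Kb + 8 * K₄) * S := by
      rw [hcBS, hα₄S]; nlinarith only [hα₀S, hS0]
    have h₂ := mul_le_mul_of_nonneg_left h₁ hC4
    have e : C4G d L * ((1 + 20 * d * KZ d L * Kb + 8 * K₄) * S) = C4G d L * (1 + 20 * d * KZ d L * Kb + 8 * K₄) * S := by ring
    linarith only [h₂, e7, e]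
  · -- 1024(d+1)(d+4)L²α₀ ≤ 1
    rw [hD8] at e8
    have h₁ : 1024 * ((d : ℝ) + 1) * ((d : ℝ) + 4) * L ^ 2 * α₀ ≤ 1024 * ((d : ℝ) + 1) * ((d : ℝ) + 4) * L ^ 2 * S :=
      mul_le_mul_of_nonneg_left hα₀S (by positivity)
    linarith only [h₁, e8]
  · -- 32(d+1)²C₆L²α₀ ≤ 1
    rw [hD9] at e9
    have h₁ : 32 * ((d : ℝ) + 1) ^ 2 * C6 d * L ^ 2 * α₀ ≤ 32 * ((d : ℝ) + 1) ^ 2 * C6 d * L ^ 2 * S :=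
      mul_le_mul_of_nonneg_left hα₀S (by positivity)
    linarith only [h₁, e9]
  · -- 16 d C₅′ C₆ L² α₀ ≤ 1
    rw [hD10] at e10
    have h₁ : 16 * d * C5' d * C6 d * (L : ℝ) ^ 2 * α₀ ≤ 16 * d * C5' d * C6 d * (L : ℝ) ^ 2 * S :=
      mul_le_mul_of_nonneg_left hα₀S (by positivity)
    linarith only [h₁, e10]
  · -- 8 d C₆ L α₀ ≤ 1
    rw [hD11] at e11
    have h₁ : 8 * d * C6 d * L * α₀ ≤ 8 * d * C6 d * L * S := mul_le_mul_of_nonneg_left hα₀S (by positivity)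
    linarith only [h₁, e11]
  · -- 40 d c_B + α₄ ≤ 1/(4B₀′_H·2C′₂)
    rw [hD12] at e12
    have hden : 0 < 4 * B₀'H * (2 * C2p d) := by positivity
    rw [le_div_iff₀ hden]
    have e : (20 * d * KZ d L * Kb + K₄) * (8 * B₀'H * C2p d) * S = (20 * d * KZ d L * cB + α₄) * (4 * B₀'H * (2 * C2p d)) := by
      rw [hcBS, hα₄S]; ring
    linarith only [e12, e]
  · -- 2C₆(40 d c_B + 4α₄) ≤ 1/8
    rw [hD13] at e13
    have e : 16 * C6 d * (20 * d * KZ d L * Kb + 4 * K₄) * S = 8 * (2 * C6 d * (20 * d * KZ d L * cB + 4 * α₄)) := by rw [hcBS, hα₄S]; ring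
    linarith only [e13, e]
  · -- c_B ≤ 1/13
    rw [hD14] at e14
    have e : 13 * Kb * S = 13 * cB := by rw [hcBS]; ring
    linarith only [e14, e]
  · -- α₄/4 + hE ≤ 1/24
    rw [hD16] at e16
    nlinarith only [hb₁S, e16, hKb₁0, hS0]
  · -- α₄/4 + hE ≤ 1/140
    rw [hD16] at e16
    nlinarith only [hb₁S, e16, hKb₁0, hS0]
  · -- 10(α₄/4 + hE)B_R ≤ 1/2
    rw [hD17] at e17
    have h₁ : 10 * (α₄ / 4 + hE) * BR ≤ 10 * (Kb₁ * S) * BR :=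
      mul_le_mul_of_nonneg_right (mul_le_mul_of_nonneg_left hb₁S (by norm_num)) hBR
    have e : 10 * (Kb₁ * S) * BR = (20 * BR * Kb₁ * S) / 2 := by ring
    linarith only [h₁, e, e17]
  · -- (1.103): B_G·M ≤ α₄/4 (§2 `h103_of_scales`)
    rw [hD20] at e20
    exact h103_of_scales hBG hBR hB₀' hK₁0 hS0 hfree hKDA hb₁0 hb₁S hcB0 hcBS.le hE₂S.le hcDAS.le hR e20 (by rw [hα₄S, hK₄]; ring)
  · -- (1.106): B_G·K ≤ 1/2 (§2 `h106_of_scales`)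
    rw [hD19] at e19
    exact h106_of_scales hBG hBR hS2 hKb0.le hKb₁0 hb₁0 hb₁S hcB0 hcBS.le hhE₂0 hE₂S' hcDA0 hcDAS.le hlE₂S.le (by positivity)
      (by linarith only [hlE1]) hR hKmW hKKW hKKc e19

end Literature.MathematicalPhysics.QuantumFieldTheory.Balaban1983to89.B8SockHFPWindowsRec

end
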